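import Literature.AlgebraicGeometry.Frobenioids.PerfFactorialOrderIsoFix
import Literature.AlgebraicGeometry.Frobenioids.DivisorMonoidTransport
import Literature.AlgebraicGeometry.Frobenioids.FrobeniusTypePerfect
import Literature.AlgebraicGeometry.Frobenioids.ElementaryIsomorphisms
import Literature.AlgebraicGeometry.Frobenioids.BiratUnitsPush
import HarnessLib

/-!
# [FrdI] Theorem 4.9, proof p. 89 ll. 9–17: the divisor transport is multiplicative at every object
# admitting a pre-step to an object where "right-hand = left-hand", and multiplicativity propagates
# forward along pre-steps

Mochizuki, *The geometry of Frobenioids I: the general theory*, Kyushu J. Math. **62** (2008)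
293–400, §4, proof of Theorem 4.9, kurims p. 89 ll. 9–17 [cite: MochizukiFrdI2008, Thm. 4.9 p.89]:
"if the right-hand and left-hand isomorphisms of Theorem 4.2, (iii), coincide for all universally
Div-Frobenius-trivial objects, then it follows immediately from the construction of … `Ψ^Prime` …
that `Ψ^Prime` extends, for `A_i ∈ Ob(C_i^bs-iso)` …, to an isomorphism of monoids … functorial in
`A₁`" — the EXTENSION STEP from the (universally) Div-Frobenius-trivial objects to arbitrary objects,
carried out for the tree's direct rendering of `Ψ^Φ`: the divisor transport
`T_A : Φ₁(A) → Φ₂(ΨA)`, `Div φ ↦ Div(Ψφ)` (Def. 1.3 (iii)(d); `PreFrobenioid.exists_divTransport`,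
seat abc-iut-w4-d099), given here as ANY family of maps `T` with that defining property.

PROOF-ONLY; nothing is defined. For Frobenioids of isotropic type and `Ψ` preserving pre-steps:

* `transport_mul_pull` (Rem. 1.1.1 on `φ ∘ ψ` for pre-steps `ψ : W → O`, `φ` out of `O`):
  `T_W(Div ψ · ψ^*z) = (Ψψ)^* T_O(z) · T_W(Div ψ)`.
* `transport_pull_of_dvd_div` — the "window below `Div ψ`": if `T_O` is multiplicative and satisfies
  the LEFT-HAND clause at `O` ("`(Ψχ)^* T_O(z) = Div(Ψχ)` whenever `χ^* z = Div χ` for a pre-step `χ`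
  into `O`", i.e. right-hand = left-hand at `O` in the form of `FrdI.T49.RightEqLeftAt`), then
  `T_W(ψ^* z) = (Ψψ)^* T_O(z)` for every `ψ^* z ≤ Div ψ` (factor `ψ` through the pre-step with zero
  divisor `ψ^* z`, Def. 1.3 (iii)(d), and read divisors of the `Ψ`-images).
* `transport_mul_of_preStep_to` — **the extension step**: under the same hypotheses at `O` (and `C₁` of
  perfect type, `Φ₁` perf-factorial), `T_W` is MULTIPLICATIVE for every `W` admitting a pre-step
  `ψ : W → O`: `T_W` and the conjugate `(Ψψ)^* ∘ T_O ∘ ψ_*` are order-isomorphisms which agree on the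
  divisors and on the multiples of `Div ψ`, hence coincide (`IsPerfFactorial.eq_of_dvd_iff_of_eq_on`).
* `transport_mul_of_preStep_from` — multiplicativity of `T` propagates FORWARD along pre-steps
  `Y → X` (Rem. 1.1.1 and the cancellation law).

Consumer: `Thm49SufficesRightEqLeftProofs.lean` (every object receives a pre-step from an object which
admits a pre-step to a Frobenius-trivial — hence universally Div-Frobenius-trivial — object,
Def. 1.3 (i)(a)(b)). Nothing here bears on [IUTchIII].
-/

namespace Literature.AlgebraicGeometry.Frobenioids

open CategoryTheory Opposite

universe w v v' u u'

namespace PreFrobenioid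

variable {D₁ : Type u} [Category.{v} D₁] {Φ₁ : D₁ᵒᵖ ⥤ CommMonCat.{w}} {C₁ : Type u'}
  [Category.{v'} C₁] {D₂ : Type u} [Category.{v} D₂] {Φ₂ : D₂ᵒᵖ ⥤ CommMonCat.{w}} {C₂ : Type u'}
  [Category.{v'} C₂] {F₁ : C₁ ⥤ ElemFrobenioid Φ₁} {F₂ : C₂ ⥤ ElemFrobenioid Φ₂}

/-! ### Pull-backs along isomorphisms of the base
(bookkeeping; `pull_inv_pull`, `pull_pull_inv` are in `ElementaryIsomorphisms.lean`,
`RatFrac.pull_bijective_of_isIso` in `BiratUnitsPush.lean`) -/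

section PullIso

variable {D : Type u} [Category.{v} D] (Φ : Dᵒᵖ ⥤ CommMonCat.{w})

/-- `f^*` preserves and reflects `≤` for an isomorphism `f`. [cite: MochizukiFrdI2008, Def. 1.1(ii)] -/
theorem pull_dvd_iff_of_isIso {X Y : D} (f : X ⟶ Y) [IsIso f] (a b : Φ.obj (op Y)) :
    a ∣ b ↔ pull Φ f a ∣ pull Φ f b := by
  refine ⟨fun h => map_dvd _ h, fun h => ?_⟩
  have h' := map_dvd (pull Φ (inv f)) h
  rwa [pull_inv_pull, pull_inv_pull] at h'

end PullIso

/-! ### The divisor calculus of the transport -/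

/-- **Rem. 1.1.1 for the transport along a pre-step.** For Frobenioids of isotropic type, `Ψ`
preserving pre-steps, and any family `T_A : Φ₁(A) → Φ₂(ΨA)` with `T_A(Div φ) = Div(Ψφ)` for pre-steps
`φ` out of `A`: for a pre-step `ψ : W → O` and `z ∈ Φ₁(O)`,
`T_W(Div ψ · ψ^* z) = (Ψψ)^* T_O(z) · T_W(Div ψ)` — both sides are `Div Ψ(φ ∘ ψ)` for a pre-step
`φ` out of `O` with `Div φ = z` (Def. 1.3 (iii)(d)). [cite: MochizukiFrdI2008, Thm. 4.9 p.89] -/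
theorem transport_mul_pull (Ψ : C₁ ≌ C₂) (hF₁ : IsFrobenioid F₁)
    (hpre : ∀ ⦃X Y : C₁⦄ (φ : X ⟶ Y), IsPreStep F₁ φ → IsPreStep F₂ (Ψ.functor.map φ))
    (T : ∀ A : C₁, Φ₁.obj (op (baseObj F₁ A)) → Φ₂.obj (op (baseObj F₂ (Ψ.functor.obj A))))
    (hT : ∀ ⦃A B : C₁⦄ (φ : A ⟶ B), IsPreStep F₁ φ → T A (Div F₁ φ) = Div F₂ (Ψ.functor.map φ))
    {W O : C₁} (ψ : W ⟶ O) (hψ : IsPreStep F₁ ψ) (z : Φ₁.obj (op (baseObj F₁ O))) :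
    T W (Div F₁ ψ * pull Φ₁ (Base F₁ ψ) z) =
      pull Φ₂ (Base F₂ (Ψ.functor.map ψ)) (T O z) * T W (Div F₁ ψ) := by
  obtain ⟨O', φ, hφ, hφz⟩ := hF₁.iii_d_under_surj O z
  have hcomp : IsPreStep F₁ (ψ ≫ φ) := IsPreStep.comp F₁ hψ hφ.2
  have h1 : Div F₁ (ψ ≫ φ) = Div F₁ ψ * pull Φ₁ (Base F₁ ψ) z := by
    rw [div_comp, hφz, show degFr F₁ φ = 1 from hφ.2.1, PNat.one_coe, pow_one, mul_comm]
  have h2 : Div F₂ (Ψ.functor.map (ψ ≫ φ)) =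
      pull Φ₂ (Base F₂ (Ψ.functor.map ψ)) (T O z) * T W (Div F₁ ψ) := by
    rw [Functor.map_comp, div_comp, show degFr F₂ (Ψ.functor.map φ) = 1 from (hpre φ hφ.2).1,
      PNat.one_coe, pow_one, ← hT φ hφ.2, hφz, ← hT ψ hψ]
  rw [← h1, hT _ hcomp, h2]

/-- **The base point.** If `T_O` satisfies the left-hand clause at `O` then for a pre-step
`ψ : W → O` and `z₀` with `ψ^* z₀ = Div ψ` (i.e. `z₀ = ψ_* Div ψ`): `T_W(Div ψ) = (Ψψ)^* T_O(z₀)`.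
[cite: MochizukiFrdI2008, Thm. 4.9 p.89] -/
theorem transport_div_eq_pull (Ψ : C₁ ≌ C₂)
    (T : ∀ A : C₁, Φ₁.obj (op (baseObj F₁ A)) → Φ₂.obj (op (baseObj F₂ (Ψ.functor.obj A))))
    (hT : ∀ ⦃A B : C₁⦄ (φ : A ⟶ B), IsPreStep F₁ φ → T A (Div F₁ φ) = Div F₂ (Ψ.functor.map φ))
    {O : C₁}
    (hRL : ∀ ⦃W' : C₁⦄ (χ : W' ⟶ O), IsPreStep F₁ χ → ∀ z : Φ₁.obj (op (baseObj F₁ O)),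
      pull Φ₁ (Base F₁ χ) z = Div F₁ χ →
        pull Φ₂ (Base F₂ (Ψ.functor.map χ)) (T O z) = Div F₂ (Ψ.functor.map χ))
    {W : C₁} (ψ : W ⟶ O) (hψ : IsPreStep F₁ ψ) (z₀ : Φ₁.obj (op (baseObj F₁ O)))
    (hz₀ : pull Φ₁ (Base F₁ ψ) z₀ = Div F₁ ψ) :
    T W (Div F₁ ψ) = pull Φ₂ (Base F₂ (Ψ.functor.map ψ)) (T O z₀) := by
  rw [hT ψ hψ, hRL ψ hψ z₀ hz₀]

/-- **Multiples of `Div ψ`.** Under the left-hand clause at `O` and multiplicativity of `T_O`: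
`T_W(Div ψ · ψ^* z) = (Ψψ)^* T_O(z₀ · z)` for `ψ^* z₀ = Div ψ`.
[cite: MochizukiFrdI2008, Thm. 4.9 p.89] -/
theorem transport_mul_pull_eq (Ψ : C₁ ≌ C₂) (hF₁ : IsFrobenioid F₁)
    (hpre : ∀ ⦃X Y : C₁⦄ (φ : X ⟶ Y), IsPreStep F₁ φ → IsPreStep F₂ (Ψ.functor.map φ))
    (T : ∀ A : C₁, Φ₁.obj (op (baseObj F₁ A)) → Φ₂.obj (op (baseObj F₂ (Ψ.functor.obj A))))
    (hT : ∀ ⦃A B : C₁⦄ (φ : A ⟶ B), IsPreStep F₁ φ → T A (Div F₁ φ) = Div F₂ (Ψ.functor.map φ))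
    {O : C₁} (hmulO : ∀ a b, T O (a * b) = T O a * T O b)
    (hRL : ∀ ⦃W' : C₁⦄ (χ : W' ⟶ O), IsPreStep F₁ χ → ∀ z : Φ₁.obj (op (baseObj F₁ O)),
      pull Φ₁ (Base F₁ χ) z = Div F₁ χ →
        pull Φ₂ (Base F₂ (Ψ.functor.map χ)) (T O z) = Div F₂ (Ψ.functor.map χ))
    {W : C₁} (ψ : W ⟶ O) (hψ : IsPreStep F₁ ψ) (z₀ : Φ₁.obj (op (baseObj F₁ O)))
    (hz₀ : pull Φ₁ (Base F₁ ψ) z₀ = Div F₁ ψ) (z : Φ₁.obj (op (baseObj F₁ O))) :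
    T W (Div F₁ ψ * pull Φ₁ (Base F₁ ψ) z) = pull Φ₂ (Base F₂ (Ψ.functor.map ψ)) (T O (z₀ * z)) := by
  rw [transport_mul_pull Ψ hF₁ hpre T hT ψ hψ z, transport_div_eq_pull Ψ T hT hRL ψ hψ z₀ hz₀,
    hmulO, map_mul, mul_comm]

/-- **The window below `Div ψ`.** Under the left-hand clause at `O` and multiplicativity of `T_O`, for
a pre-step `ψ : W → O` and `z ∈ Φ₁(O)` with `ψ^* z ≤ Div ψ`: `T_W(ψ^* z) = (Ψψ)^* T_O(z)`. (Factor
`ψ = ψ'' ∘ φ` through the pre-step `φ` out of `W` with `Div φ = ψ^* z`, Def. 1.3 (iii)(d); then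
`Div Ψψ = (Ψφ)^* Div Ψψ'' + Div Ψφ`, the left-hand clause computes `Div Ψψ''` and `Div Ψψ`, and one
cancels.) [cite: MochizukiFrdI2008, Thm. 4.9 p.89] -/
theorem transport_pull_of_dvd_div (Ψ : C₁ ≌ C₂) (hF₁ : IsFrobenioid F₁) (hF₂ : IsFrobenioid F₂)
    (histr₁ : IsOfIsotropicType F₁)
    (hpre : ∀ ⦃X Y : C₁⦄ (φ : X ⟶ Y), IsPreStep F₁ φ → IsPreStep F₂ (Ψ.functor.map φ))
    (T : ∀ A : C₁, Φ₁.obj (op (baseObj F₁ A)) → Φ₂.obj (op (baseObj F₂ (Ψ.functor.obj A))))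
    (hT : ∀ ⦃A B : C₁⦄ (φ : A ⟶ B), IsPreStep F₁ φ → T A (Div F₁ φ) = Div F₂ (Ψ.functor.map φ))
    {O : C₁} (hmulO : ∀ a b, T O (a * b) = T O a * T O b)
    (hRL : ∀ ⦃W' : C₁⦄ (χ : W' ⟶ O), IsPreStep F₁ χ → ∀ z : Φ₁.obj (op (baseObj F₁ O)),
      pull Φ₁ (Base F₁ χ) z = Div F₁ χ →
        pull Φ₂ (Base F₂ (Ψ.functor.map χ)) (T O z) = Div F₂ (Ψ.functor.map χ))
    {W : C₁} (ψ : W ⟶ O) (hψ : IsPreStep F₁ ψ) (z : Φ₁.obj (op (baseObj F₁ O)))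
    (hz : pull Φ₁ (Base F₁ ψ) z ∣ Div F₁ ψ) :
    T W (pull Φ₁ (Base F₁ ψ) z) = pull Φ₂ (Base F₂ (Ψ.functor.map ψ)) (T O z) := by
  have hco₁ : ∀ {X Y : C₁} (f : X ⟶ Y), IsCoAngular F₁ f :=
    fun f => isCoAngular_of_isIsotropic_codomains F₁ f fun Z _ => histr₁ Z
  haveI : IsCancelMul (Φ₁.obj (op (baseObj F₁ W))) := isIntegral_iff_isCancelMul.mp
    (hF₁.isPreFrobenioid.isDivisorial _).isPreDivisorial.isIntegral
  haveI : IsCancelMul (Φ₂.obj (op (baseObj F₂ (Ψ.functor.obj W)))) := isIntegral_iff_isCancelMul.mp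
    (hF₂.isPreFrobenioid.isDivisorial _).isPreDivisorial.isIntegral
  haveI : IsIso (Base F₁ ψ) := hψ.2
  set y := pull Φ₁ (Base F₁ ψ) z with hy
  obtain ⟨y', hy'⟩ := hz
  -- the pre-step `φ` out of `W` with `Div φ = y`, and the factorisation `ψ = φ ≫ ψ''`
  obtain ⟨Wy, φ, hφ, hφy⟩ := hF₁.iii_d_under_surj W y
  obtain ⟨ψ'', hψ'', hfac⟩ := hF₁.iii_d_under_full φ ψ hφ ⟨hco₁ ψ, hψ⟩ (by rw [hφy]; exact ⟨y', hy'⟩)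
  haveI : IsIso (Base F₁ φ) := hφ.2.2
  -- `φ^* Div ψ'' = y'`
  have hd : pull Φ₁ (Base F₁ φ) (Div F₁ ψ'') = y' := by
    have h1 : Div F₁ ψ = pull Φ₁ (Base F₁ φ) (Div F₁ ψ'') * y := by
      rw [← hfac, div_comp, hφy, show degFr F₁ ψ'' = 1 from hψ''.2.1, PNat.one_coe, pow_one]
    rw [hy', mul_comm y y'] at h1
    exact (mul_right_cancel h1).symm
  -- `z' := ψ_* y'` satisfies `ψ''^* z' = Div ψ''`
  set z' := pull Φ₁ (inv (Base F₁ ψ)) y' with hz'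
  have hz'ψ : pull Φ₁ (Base F₁ ψ) z' = y' := by rw [hz', pull_pull_inv]
  have hz'' : pull Φ₁ (Base F₁ ψ'') z' = Div F₁ ψ'' := by
    apply (RatFrac.pull_bijective_of_isIso (Φ := Φ₁) (Base F₁ φ)).1
    rw [hd, ← pull_comp, ← base_comp, hfac, hz'ψ]
  -- `z₀ := z · z'` satisfies `ψ^* z₀ = Div ψ`
  have hz₀ : pull Φ₁ (Base F₁ ψ) (z * z') = Div F₁ ψ := by rw [map_mul, hz'ψ, ← hy, hy']
  -- compute `T_W(Div ψ)` in two ways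
  have e1 : T W (Div F₁ ψ) = pull Φ₂ (Base F₂ (Ψ.functor.map ψ)) (T O z') * T W y := by
    rw [hT ψ hψ, ← hfac, Functor.map_comp, div_comp,
      show degFr F₂ (Ψ.functor.map ψ'') = 1 from (hpre ψ'' hψ''.2).1, PNat.one_coe, pow_one,
      ← hRL ψ'' hψ''.2 z' hz'', ← pull_comp, ← base_comp, ← Functor.map_comp, ← hT φ hφ.2, hφy]
  have e2 : T W (Div F₁ ψ) = pull Φ₂ (Base F₂ (Ψ.functor.map ψ)) (T O z) *
      pull Φ₂ (Base F₂ (Ψ.functor.map ψ)) (T O z') := by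
    rw [transport_div_eq_pull Ψ T hT hRL ψ hψ (z * z') hz₀, hmulO, map_mul]
  rw [e1, mul_comm] at e2
  exact mul_right_cancel e2

/-- **The extension step of the proof of Thm. 4.9 (p. 89 ll. 9–17), for the divisor transport.**
Frobenioids of isotropic type, `C₁` of perfect type, `Φ₁` perf-factorial, `Ψ` preserving pre-steps;
`T` any family with `T_A(Div φ) = Div(Ψφ)`, each `T_A` a bijection compatible with `≤`. If at the
object `O` the map `T_O` is multiplicative and satisfies the left-hand clause (right-hand = left-hand
at `O`), then `T_W` is multiplicative for EVERY object `W` admitting a pre-step `ψ : W → O` — indeed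
`T_W` coincides with `(Ψψ)^* ∘ T_O ∘ ψ_*` (they agree on the divisors and on the multiples of `Div ψ`,
`IsPerfFactorial.eq_of_dvd_iff_of_eq_on`). [cite: MochizukiFrdI2008, Thm. 4.9 p.89] -/
theorem transport_mul_of_preStep_to (Ψ : C₁ ≌ C₂) (hF₁ : IsFrobenioid F₁) (hF₂ : IsFrobenioid F₂)
    (hperf₁ : IsOfPerfectType F₁) (histr₁ : IsOfIsotropicType F₁)
    (hpf₁ : Objectwise (fun M _ => IsPerfFactorial M) Φ₁)
    (hpre : ∀ ⦃X Y : C₁⦄ (φ : X ⟶ Y), IsPreStep F₁ φ → IsPreStep F₂ (Ψ.functor.map φ))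
    (T : ∀ A : C₁, Φ₁.obj (op (baseObj F₁ A)) → Φ₂.obj (op (baseObj F₂ (Ψ.functor.obj A))))
    (hTb : ∀ A, Function.Bijective (T A)) (hTd : ∀ A (x y), x ∣ y ↔ T A x ∣ T A y)
    (hT : ∀ ⦃A B : C₁⦄ (φ : A ⟶ B), IsPreStep F₁ φ → T A (Div F₁ φ) = Div F₂ (Ψ.functor.map φ))
    {O : C₁} (hmulO : ∀ a b, T O (a * b) = T O a * T O b)
    (hRL : ∀ ⦃W' : C₁⦄ (χ : W' ⟶ O), IsPreStep F₁ χ → ∀ z : Φ₁.obj (op (baseObj F₁ O)),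
      pull Φ₁ (Base F₁ χ) z = Div F₁ χ →
        pull Φ₂ (Base F₂ (Ψ.functor.map χ)) (T O z) = Div F₂ (Ψ.functor.map χ))
    {W : C₁} (ψ : W ⟶ O) (hψ : IsPreStep F₁ ψ) (a b : Φ₁.obj (op (baseObj F₁ W))) :
    T W (a * b) = T W a * T W b := by
  haveI : IsIso (Base F₁ ψ) := hψ.2
  haveI : IsIso (Base F₂ (Ψ.functor.map ψ)) := (hpre ψ hψ).2
  -- the conjugate `g := (Ψψ)^* ∘ T_O ∘ ψ_*`
  let g : Φ₁.obj (op (baseObj F₁ W)) → Φ₂.obj (op (baseObj F₂ (Ψ.functor.obj W))) :=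
    fun y => pull Φ₂ (Base F₂ (Ψ.functor.map ψ)) (T O (pull Φ₁ (inv (Base F₁ ψ)) y))
  have hg_mul : ∀ a b, g (a * b) = g a * g b := by
    intro a b; simp only [g, map_mul, hmulO]
  have hgb : Function.Bijective g :=
    (RatFrac.pull_bijective_of_isIso (Φ := Φ₂) (Base F₂ (Ψ.functor.map ψ))).comp
      ((hTb O).comp (RatFrac.pull_bijective_of_isIso (Φ := Φ₁) (inv (Base F₁ ψ))))
  have hgd : ∀ x y, x ∣ y ↔ g x ∣ g y := by
    intro x y
    simp only [g]
    rw [← pull_dvd_iff_of_isIso, ← hTd O, ← pull_dvd_iff_of_isIso]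
  -- `T_W` and `g` agree on the divisors and on the multiples of `Div ψ`
  have h₁ : ∀ p, IsPrimary p → p ∣ Div F₁ ψ → T W p = g p := by
    intro p _ hp
    have hp' : pull Φ₁ (Base F₁ ψ) (pull Φ₁ (inv (Base F₁ ψ)) p) ∣ Div F₁ ψ := by rwa [pull_pull_inv]
    have h := transport_pull_of_dvd_div Ψ hF₁ hF₂ histr₁ hpre T hT hmulO hRL ψ hψ _ hp'
    rwa [pull_pull_inv] at h
  have h₂ : ∀ y, T W (Div F₁ ψ * y) = g (Div F₁ ψ * y) := by
    intro y
    have h := transport_mul_pull_eq Ψ hF₁ hpre T hT hmulO hRL ψ hψ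
      (pull Φ₁ (inv (Base F₁ ψ)) (Div F₁ ψ)) (pull_pull_inv Φ₁ _ _) (pull Φ₁ (inv (Base F₁ ψ)) y)
    rw [pull_pull_inv] at h
    rw [h]
    simp only [g, map_mul]
  have hMp := isPerfect_divisorMonoid hF₁ hperf₁ W
  have heq : ∀ y, T W y = g y :=
    IsPerfFactorial.eq_of_dvd_iff_of_eq_on (hpf₁ _) hMp (T W) g (hTb W) hgb (hTd W) hgd (Div F₁ ψ) h₁ h₂
  rw [heq, heq, heq, hg_mul]

/-- **Multiplicativity propagates forward along pre-steps.** If `T_Y` is multiplicative and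
`ψ : Y → X` is a pre-step then `T_X` is multiplicative: `T_Y(Div ψ · ψ^* z) = (Ψψ)^* T_X(z) · T_Y(Div ψ)`
(Rem. 1.1.1) and cancellation give `T_Y ∘ ψ^* = (Ψψ)^* ∘ T_X`, and `(Ψψ)^*` is injective.
[cite: MochizukiFrdI2008, Thm. 4.9 p.89] -/
theorem transport_mul_of_preStep_from (Ψ : C₁ ≌ C₂) (hF₁ : IsFrobenioid F₁) (hF₂ : IsFrobenioid F₂)
    (hpre : ∀ ⦃X Y : C₁⦄ (φ : X ⟶ Y), IsPreStep F₁ φ → IsPreStep F₂ (Ψ.functor.map φ))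
    (T : ∀ A : C₁, Φ₁.obj (op (baseObj F₁ A)) → Φ₂.obj (op (baseObj F₂ (Ψ.functor.obj A))))
    (hT : ∀ ⦃A B : C₁⦄ (φ : A ⟶ B), IsPreStep F₁ φ → T A (Div F₁ φ) = Div F₂ (Ψ.functor.map φ))
    {Y X : C₁} (ψ : Y ⟶ X) (hψ : IsPreStep F₁ ψ) (hmulY : ∀ a b, T Y (a * b) = T Y a * T Y b)
    (a b : Φ₁.obj (op (baseObj F₁ X))) : T X (a * b) = T X a * T X b := by
  haveI : IsCancelMul (Φ₂.obj (op (baseObj F₂ (Ψ.functor.obj Y)))) := isIntegral_iff_isCancelMul.mp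
    (hF₂.isPreFrobenioid.isDivisorial _).isPreDivisorial.isIntegral
  -- `T_Y(ψ^* z) = (Ψψ)^* T_X(z)`
  have hnat : ∀ z, T Y (pull Φ₁ (Base F₁ ψ) z) = pull Φ₂ (Base F₂ (Ψ.functor.map ψ)) (T X z) := by
    intro z
    have h := transport_mul_pull Ψ hF₁ hpre T hT ψ hψ z
    rw [hmulY, mul_comm] at h
    exact mul_right_cancel h
  apply (hF₂.isPreFrobenioid.isMonoidOn.isCharInjective (Base F₂ (Ψ.functor.map ψ))).1
  rw [map_mul, ← hnat, ← hnat, ← hnat, map_mul, hmulY]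

end PreFrobenioid

end Literature.AlgebraicGeometry.Frobenioids
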